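import Literature.Barriers.ABC.BakerMethodBoundsProofs
import Literature.Barriers.ABC.BakerMethodBoundsArchimedeanProofs
import HarnessLib

/-!
# Pasten 2024, Theorem 1.4 (1) (`pasten2024_thm_1_4_1`): decomposition record

Barrier catalogue `Literature/Barriers/ABC/` (D-0021); theorems only.  The named fact
`Literature.Barriers.ABC.pasten2024_thm_1_4_1` (`BakerMethodBounds.lean`; H. Pasten, *The largest
prime factor of `n² + 1` and improvements on subexponential ABC*, Invent. Math. 236 (2024),
Theorem 1.4 (1): `a ≤ c^{1−η}` ⟹ `log c ≤ η⁻¹ exp(κ √((log R) log₂ R))`) is proved in the tree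
(`BakerMethodBoundsProofs.lean`, `BakerMethodBoundsSubexpProofs.lean`,
`BakerMethodBoundsArchimedeanProofs.lean`: §4 of the paper in full) from the two EXISTING named
facts that the printed proof imports — the children of the decomposition recorded here:

1. a lower bound for linear forms in logarithms over `ℚ`: either Evertse–Győry's Theorem 4.2.1
   (`Literature.NumberTheory.DiophantineGeometry.Dioph.evertseGyory_thm_4_2_1_rat`, giving
   Pasten's Theorem 2.1 by `pasten2024_thm_2_1`) or Baker–Wüstholz 1993
   (`Literature.NumberTheory.DiophantineGeometry.baker_wustholz ℚ`);
2. Pasten's Shimura-curve bound, Theorem 2.5 (`Literature.NumberTheory.DiophantineGeometry.pasten2024_thm_2_5`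
   = *Shimura curves and the abc conjecture*, J. Number Theory 254 (2024), Thm. 16.8).

The third printed input, an exponential abc bound (Stewart–Tijdeman), follows from 1 and is not
a child.  Assemblies: `pasten2024_thm_1_4_1_holds_of` (= `pasten2024_thm_1_4_1_of_facts`) and
`pasten2024_thm_1_4_1_holds_of_bakerWustholz` (= `pasten2024_thm_1_4_1_of_bakerWustholz_rat`).
No statement is introduced; neither child is the parent reworded (1 is a transcendence estimate,
2 a bound on `∏ ν_p(abc)`).

## References

* H. Pasten, *The largest prime factor of `n² + 1` and improvements on subexponential ABC*,
  Invent. Math. 236 (2024): Thm. 1.4, Thm. 2.1, Thm. 2.5, §4. [Pasten2024]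
* J.-H. Evertse, K. Győry, *Unit Equations in Diophantine Number Theory* (2015), Thm. 4.2.1.
  [EvertseGyory2015]
* A. Baker, G. Wüstholz, *Logarithmic forms and group varieties*, J. reine angew. Math. 442
  (1993), Theorem. [BakerWustholz1993]
-/

noncomputable section

open Literature.NumberTheory.DiophantineGeometry
open Literature.NumberTheory.DiophantineGeometry.Dioph

namespace Literature.Barriers.ABC

/-- **Assembly: Pasten's Theorem 1.4 (1) from its two printed inputs** — linear forms in
logarithms over `ℚ` in Evertse–Győry's form (Theorem 4.2.1) and the Shimura-curve bound
Theorem 2.5 — by `pasten2024_thm_1_4_1_of_facts` (`BakerMethodBoundsProofs.lean`).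
[cite: Pasten2024, Theorem 1.4 (1) and §4] -/
theorem pasten2024_thm_1_4_1_holds_of :
    evertseGyory_thm_4_2_1_rat → pasten2024_thm_2_5 → pasten2024_thm_1_4_1 :=
  fun h₁ h₂ => pasten2024_thm_1_4_1_of_facts h₁ h₂

/-- **Assembly, Baker–Wüstholz variant**: Theorem 1.4 (1) from Baker–Wüstholz 1993 over `ℚ`
(`baker_wustholz ℚ`) and Theorem 2.5, by `pasten2024_thm_1_4_1_of_bakerWustholz_rat`
(`BakerMethodBoundsArchimedeanProofs.lean`, `κ = 48`). [cite: Pasten2024, Theorem 1.4 (1)] [cite: BakerWustholz1993, Theorem] -/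
theorem pasten2024_thm_1_4_1_holds_of_bakerWustholz :
    baker_wustholz ℚ → pasten2024_thm_2_5 → pasten2024_thm_1_4_1 :=
  fun hBW hSh => pasten2024_thm_1_4_1_of_bakerWustholz_rat hBW hSh

end Literature.Barriers.ABC
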